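import Literature.MathematicalPhysics.QuantumFieldTheory.MassGapTimeOrderedDetermined
import HarnessLib

/-!
# Non-triviality of QCD OS data is decided by the scheme; no non-trivial data along `z ≡ 0`

Bookkeeping on top of `QCDOS.lean` / `MassGapTimeOrderedDetermined.lean` (harness vocabulary `OSData.IsNontrivial`,
`IsQCDAlong`, `qcdLatticeSchwinger`), recorded 2026-08-17 from the junk audit of crux `ChiralGluonicCompletion`
(stmt-QuantumFields-17498, line `Sketch`, stub `stub_continuum`):

* `OSData.isNontrivial_of_eqOn_isTimeOrdered` / `…_iff_…` — if the Schwinger functions of two OS data agree on all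
  time-ordered test functions in every degree `n ≥ 1`, they are non-trivial in the same fields (the test functions of
  `IsNontrivial` are `ΘF* ⊗ G`, `ΘF*`, `G` with `F`, `G` time-ordered; E0-hermiticity for `ΘF*`).
* `IsQCDAlong.isNontrivial_iff` — two OS data that are QCD along the SAME scheme are non-trivial in the same fields
  (tree `IsQCDAlong.schwinger_eq_of_isTimeOrdered`): non-triviality is a property of the scheme.
* `qcdLatticeSchwinger_eq_zero_of_z`, `IsQCDAlong.vacuum_of_z_eq_zero`, `IsQCDAlong.not_isNontrivial_of_z_eq_zero`,
  `not_isNontrivial_of_isQCDAlong_scheme_zero` — with vanishing species renormalisations `z ≡ 0` all lattice `n`-point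
  functions vanish, the vacuum is QCD along the scheme, and hence NO OS data QCD along such a scheme are non-trivial in
  any field: the `z`-component of every witness of `QCDOf` is honest (`≠ 0`), and the free choice of `T` off the
  off-diagonal real tensors pinned by `IsQCDAlong` cannot manufacture `IsNontrivial`.
Everything is a `theorem`; no definition and no named fact is introduced.
-/

open scoped SchwartzMap ComplexConjugate
open Filter Topology Complex
open Literature.MathematicalPhysics.AQFT Literature.MathematicalPhysics.QuantumLattice

noncomputable section

namespace Literature.MathematicalPhysics.QuantumFieldTheory

namespace OSData

variable {ι : Type} {d : ℕ} [NeZero d]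

/-- **Agreement on time-ordered test functions transports non-triviality of a field.** If the
Schwinger functions of `T` and `T'` agree on all time-ordered test functions in every degree
`n ≥ 1`, then `T.IsNontrivial s → T'.IsNontrivial s`: the three values `𝔖₂(ΘF* ⊗ G)`, `𝔖₁(ΘF*)`,
`𝔖₁(G)` coincide (the joint one by `schwinger_appendTensor_osAdjoint_eq_of_eqOn_isTimeOrdered` at
`t = 0`, `𝔖₁(ΘF*)` by E0-hermiticity, `𝔖₁(G)` directly). [folklore] -/
theorem isNontrivial_of_eqOn_isTimeOrdered {T T' : OSData ι d}
    (h : ∀ n : ℕ, n ≠ 0 → ∀ (k : Fin n → ι) (F : 𝓢((Fin n → EuclideanSpace ℝ (Fin d)), ℂ)),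
      IsTimeOrdered F → T.schwinger n k F = T'.schwinger n k F)
    {s : ι} (hT : T.IsNontrivial s) : T'.IsNontrivial s := by
  obtain ⟨F, G, H, hF, hG, hH, hne⟩ := hT
  refine ⟨F, G, H, hF, hG, hH, ?_⟩
  have h0 : EuclideanSpace.single (0 : Fin d) (0 : ℝ) = 0 := by
    ext i
    simp
  have hHeq : H = (osAdjoint F).appendTensor
      (translateMulti (EuclideanSpace.single (0 : Fin d) (0 : ℝ)) G) := by
    ext x
    rw [hH x, SchwartzMap.appendTensor_apply, translateMulti_apply, h0]
    simp only [sub_zero]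
  have e1 : T'.schwinger (1 + 1) (fun _ => s) H = T.schwinger (1 + 1) (fun _ => s) H := by
    rw [hHeq]
    exact (schwinger_appendTensor_osAdjoint_eq_of_eqOn_isTimeOrdered h _ hF hG le_rfl).symm
  have e2 : T'.schwinger 1 (fun _ => s) G = T.schwinger 1 (fun _ => s) G :=
    (h 1 one_ne_zero _ G hG).symm
  have e3 : T'.schwinger 1 (fun _ => s) (osAdjoint F) =
      T.schwinger 1 (fun _ => s) (osAdjoint F) := by
    have f1 := T.hermitian 1 (fun _ => s) F hF
    have f2 := T'.hermitian 1 (fun _ => s) F hF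
    simp only [Function.comp_def] at f1 f2
    have h12 := h 1 one_ne_zero (fun _ => s) F hF
    rw [f1, f2] at h12
    simpa using (congrArg conj h12).symm
  rw [e1, e2, e3]
  exact hne

/-- Agreement on time-ordered test functions decides non-triviality (iff form). [folklore] -/
theorem isNontrivial_iff_of_eqOn_isTimeOrdered {T T' : OSData ι d}
    (h : ∀ n : ℕ, n ≠ 0 → ∀ (k : Fin n → ι) (F : 𝓢((Fin n → EuclideanSpace ℝ (Fin d)), ℂ)),
      IsTimeOrdered F → T.schwinger n k F = T'.schwinger n k F)
    (s : ι) : T.IsNontrivial s ↔ T'.IsNontrivial s :=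
  ⟨isNontrivial_of_eqOn_isTimeOrdered h,
    isNontrivial_of_eqOn_isTimeOrdered fun n hn k F hF => (h n hn k F hF).symm⟩

end OSData

/-- **Non-triviality of QCD OS data is a property of the scheme**: OS data that are QCD along the
same scheme are non-trivial in exactly the same fields. [folklore] -/
theorem IsQCDAlong.isNontrivial_iff {Nf : ℕ} {sch : QCDScheme Nf} {T T' : OSData (QCDField Nf) 4}
    (hT : IsQCDAlong sch T) (hT' : IsQCDAlong sch T') (s : QCDField Nf) :
    T.IsNontrivial s ↔ T'.IsNontrivial s :=
  OSData.isNontrivial_iff_of_eqOn_isTimeOrdered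
    (fun _ hn k _ hF => hT.schwinger_eq_of_isTimeOrdered hT' hn k hF) s

/-- With `z ≡ 0` every lattice `n`-point function (`n ≥ 1`) vanishes. [folklore] -/
theorem qcdLatticeSchwinger_eq_zero_of_z {Nf : ℕ} (sch : QCDScheme Nf) (hz : sch.z = 0)
    (k n : ℕ) (hn : n ≠ 0) (σ : Fin n → QCDField Nf)
    (f : Fin n → 𝓢(EuclideanSpace ℝ (Fin 4), ℝ)) :
    qcdLatticeSchwinger sch k n σ f = 0 := by
  obtain ⟨j, rfl⟩ := Nat.exists_eq_succ_of_ne_zero hn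
  simp [qcdLatticeSchwinger, smearedInsertion, List.ofFn_succ, hz]

/-- **Along a scheme with `z ≡ 0` that carries ANY QCD OS data, the vacuum is QCD too** (asymptotic
scaling and the physical branch are scheme-side; all lattice functions vanish). [folklore] -/
theorem IsQCDAlong.vacuum_of_z_eq_zero {Nf : ℕ} {sch : QCDScheme Nf} {T : OSData (QCDField Nf) 4}
    (hT : IsQCDAlong sch T) (hz : sch.z = 0) :
    IsQCDAlong sch (OSData.vacuum (QCDField Nf) 4) := by
  refine ⟨hT.1, hT.2.1, fun n hn σ f F _ _ => ?_⟩
  have hS : (OSData.vacuum (QCDField Nf) 4).schwinger n σ F = 0 := by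
    simp [OSData.vacuum, LabelledSchwingerFamily.trivial_of_ne_zero (QCDField Nf) hn]
  rw [hS]
  exact tendsto_const_nhds.congr' (Eventually.of_forall fun k =>
    (qcdLatticeSchwinger_eq_zero_of_z sch hz k n hn σ f).symm)

/-- **No junk through `z ≡ 0`**: whatever OS data `T` one chooses, if `T` is QCD along a scheme with
vanishing species renormalisations then `T` is trivial in EVERY field — `IsQCDAlong` pins the
time-ordered Schwinger functions to those of the vacuum, and `IsNontrivial` reads only those.
[folklore] -/
theorem IsQCDAlong.not_isNontrivial_of_z_eq_zero {Nf : ℕ} {sch : QCDScheme Nf}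
    {T : OSData (QCDField Nf) 4} (hT : IsQCDAlong sch T) (hz : sch.z = 0) (s : QCDField Nf) :
    ¬ T.IsNontrivial s := fun h =>
  OSData.not_isNontrivial_vacuum s ((hT.isNontrivial_iff (hT.vacuum_of_z_eq_zero hz) s).1 h)

/-- The same at the statement's interface: along `reg.scheme m 0 shift` (any regularisation, any
mass tuple, any additive counterterms) no OS data with `IsQCDAlong` are non-trivial in any field, so
the `z`-component of every witness of `ContinuumBody`/`QCDOf` is honest (`≠ 0`). [folklore] -/
theorem not_isNontrivial_of_isQCDAlong_scheme_zero {Nf : ℕ} (reg : QCDRegularisation Nf)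
    (m : Fin Nf → ℝ) (shift : QCDField Nf → ℕ → ℝ) {T : OSData (QCDField Nf) 4}
    (hT : IsQCDAlong (reg.scheme m 0 shift) T) (s : QCDField Nf) : ¬ T.IsNontrivial s :=
  hT.not_isNontrivial_of_z_eq_zero rfl s

end Literature.MathematicalPhysics.QuantumFieldTheory

end
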